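import Mathlib.Analysis.SpecificLimits.Basic
import Literature.NumberTheory.LFunctions.DeBruijnNewmanProofs

/-!
# RiemannHypothesis / UniversalFactor — stub `stub_phiTailN` of the line `one-sided-average-sign-test`
(crux `UniversalFactor.MediumKernelNoGo`, item stmt-RiemannHypothesis-2577): the theta-series tail of `Φ`

Normalisation of `Literature/NumberTheory/LFunctions/DeBruijnNewman.lean`:
`Φ(u) = deBruijnPhi u = ∑' n, deBruijnPhiSummand n u` with
`deBruijnPhiSummand n u = (2π²(n+1)⁴e^{9u} − 3π(n+1)²e^{5u}) exp(−π(n+1)²e^{4u})`.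

Contents (all proved, no definitions):
* `UniversalFactor.phiTailN_summand_le` — each summand is at most its Gaussian majorant
  `G(n+1)`, `G(m) = 2π² m⁴ e^{9u} exp(−π m² e^{4u})`;
* `UniversalFactor.phiTailN_majorant_succ_le` — the ratio step `G(m+1) ≤ G(m)/2` for `m ≥ 1`,
  `u ≥ 0` (indeed `G(m+1)/G(m) = ((m+1)/m)⁴ exp(−π(2m+1)e^{4u}) ≤ 16 e^{−3π}`);
* `UniversalFactor.phiTailN_geom_of_succ_le` — the resulting geometric decay `G(m+k) ≤ G(m) 2^{−k}`;
* `UniversalFactor.stub_phiTailN` — for `N ≥ 1`, `u ≥ 0`: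
  `0 ≤ Φ(u) − Σ_{n<N} Φ_n(u) ≤ 2 G(N+1) = 4π²(N+1)⁴e^{9u} exp(−π(N+1)²e^{4u})`.
-/

set_option linter.dupNamespace false

noncomputable section

namespace Summit.RiemannHypothesis.RiemannHypothesis.Theorems

open MeasureTheory Set Complex
open Literature.NumberTheory.LFunctions

/-! ## The Gaussian majorant of the summands and its geometric decay -/

/-- Dropping the negative part of the `n`-th summand of `Φ`:
`Φ_n(u) ≤ 2π²(n+1)⁴ e^{9u} exp(−π(n+1)² e^{4u})`. [folklore] -/
theorem UniversalFactor.phiTailN_summand_le (n : ℕ) (u : ℝ) :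
    deBruijnPhiSummand n u ≤
      2 * Real.pi ^ 2 * ((n : ℝ) + 1) ^ 4 * Real.exp (9 * u) *
        Real.exp (-(Real.pi * ((n : ℝ) + 1) ^ 2 * Real.exp (4 * u))) := by
  unfold deBruijnPhiSummand
  refine mul_le_mul_of_nonneg_right ?_ (Real.exp_pos _).le
  have h : 0 ≤ 3 * Real.pi * ((n : ℝ) + 1) ^ 2 * Real.exp (5 * u) := by positivity
  linarith

/-- Ratio step of the Gaussian majorant `G(m) = 2π² m⁴ e^{9u} exp(−π m² e^{4u})`: for `m ≥ 1` and
`u ≥ 0`, `G(m+1) ≤ G(m)/2`, because `2(m+1)⁴ ≤ m⁴ exp(π(2m+1)e^{4u})`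
(`exp(π(2m+1)e^{4u}/4) ≥ 1 + 9/4`, `(13/8)⁴ ≥ 2`). [folklore] -/
theorem UniversalFactor.phiTailN_majorant_succ_le {m u : ℝ} (hm : 1 ≤ m) (hu : 0 ≤ u) :
    2 * Real.pi ^ 2 * (m + 1) ^ 4 * Real.exp (9 * u) *
        Real.exp (-(Real.pi * (m + 1) ^ 2 * Real.exp (4 * u))) ≤
      2 * Real.pi ^ 2 * m ^ 4 * Real.exp (9 * u) *
        Real.exp (-(Real.pi * m ^ 2 * Real.exp (4 * u))) / 2 := by
  set s : ℝ := Real.exp (4 * u) with hs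
  have hs1 : 1 ≤ s := Real.one_le_exp (by linarith)
  set E : ℝ := Real.exp (Real.pi * (2 * m + 1) * s / 4) with hE
  have hEpos : 0 < E := Real.exp_pos _
  -- `E ≥ 1 + π(2m+1)s/4 ≥ 13/4`
  have hE13 : 13 / 4 ≤ E := by
    have h1 : Real.pi * (2 * m + 1) * s / 4 + 1 ≤ E := Real.add_one_le_exp _
    have h2 : 3 * 3 * 1 ≤ Real.pi * (2 * m + 1) * s :=
      mul_le_mul (mul_le_mul Real.pi_gt_three.le (by linarith) (by norm_num)
        Real.pi_pos.le) hs1 (by norm_num) (by positivity)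
    linarith
  -- `exp(π(2m+1)s) = E⁴`
  have hE4 : Real.exp (Real.pi * (2 * m + 1) * s) = E ^ 4 := by
    rw [hE, ← Real.exp_nat_mul]
    congr 1
    push_cast
    ring
  -- the key polynomial–exponential inequality `2(m+1)⁴ ≤ m⁴ exp(π(2m+1)s)`
  have key : 2 * (m + 1) ^ 4 ≤ m ^ 4 * Real.exp (Real.pi * (2 * m + 1) * s) := by
    have hmE : 13 / 8 * (m + 1) ≤ m * E := by nlinarith
    have h4 : (13 / 8 * (m + 1)) ^ 4 ≤ (m * E) ^ 4 :=
      pow_le_pow_left₀ (by positivity) hmE 4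
    calc 2 * (m + 1) ^ 4 ≤ (13 / 8 : ℝ) ^ 4 * (m + 1) ^ 4 := by gcongr; norm_num
      _ = (13 / 8 * (m + 1)) ^ 4 := by rw [mul_pow]
      _ ≤ (m * E) ^ 4 := h4
      _ = m ^ 4 * Real.exp (Real.pi * (2 * m + 1) * s) := by rw [mul_pow, hE4]
  -- split the Gaussian: `exp(−π m² s) = exp(−π(m+1)² s) · exp(π(2m+1)s)`
  have hsplit : Real.exp (-(Real.pi * m ^ 2 * s)) =
      Real.exp (-(Real.pi * (m + 1) ^ 2 * s)) * Real.exp (Real.pi * (2 * m + 1) * s) := by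
    rw [← Real.exp_add]
    congr 1
    ring
  rw [hsplit]
  have hA : 0 ≤ 2 * Real.pi ^ 2 * Real.exp (9 * u) * Real.exp (-(Real.pi * (m + 1) ^ 2 * s)) := by
    positivity
  calc 2 * Real.pi ^ 2 * (m + 1) ^ 4 * Real.exp (9 * u) * Real.exp (-(Real.pi * (m + 1) ^ 2 * s))
      = 2 * Real.pi ^ 2 * Real.exp (9 * u) * Real.exp (-(Real.pi * (m + 1) ^ 2 * s)) *
          (2 * (m + 1) ^ 4) / 2 := by ring
    _ ≤ 2 * Real.pi ^ 2 * Real.exp (9 * u) * Real.exp (-(Real.pi * (m + 1) ^ 2 * s)) *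
          (m ^ 4 * Real.exp (Real.pi * (2 * m + 1) * s)) / 2 := by gcongr
    _ = 2 * Real.pi ^ 2 * m ^ 4 * Real.exp (9 * u) *
          (Real.exp (-(Real.pi * (m + 1) ^ 2 * s)) * Real.exp (Real.pi * (2 * m + 1) * s)) / 2 := by
        ring

/-- Geometric decay from a ratio step: if `G(m+1) ≤ G(m)/2` for all `m ≥ 1`, then
`G(m+k) ≤ G(m) (1/2)^k` for `m ≥ 1`, `k : ℕ`. [folklore] -/
theorem UniversalFactor.phiTailN_geom_of_succ_le {G : ℝ → ℝ}
    (h : ∀ m : ℝ, 1 ≤ m → G (m + 1) ≤ G m / 2) {m : ℝ} (hm : 1 ≤ m) (k : ℕ) :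
    G (m + k) ≤ G m * (1 / 2) ^ k := by
  induction k with
  | zero => simp
  | succ k ih =>
    have hk : (1 : ℝ) ≤ m + k := le_add_of_le_of_nonneg hm (Nat.cast_nonneg k)
    have hstep := h (m + k) hk
    push_cast
    rw [← add_assoc, pow_succ]
    have : G m * ((1 / 2 : ℝ) ^ k * (1 / 2)) = G m * (1 / 2) ^ k / 2 := by ring
    rw [this]
    linarith

/-! ## The tail estimate -/

/-- **Theta-series tail of `Φ` on `[0, ∞)`.** For `N ≥ 1` and `u ≥ 0`,
`0 ≤ Φ(u) − Σ_{n<N} Φ_n(u) ≤ 4π²(N+1)⁴ e^{9u} exp(−π(N+1)² e^{4u})`: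
the tail `Σ_{k≥0} Φ_{N+k}(u)` has positive terms (`deBruijnPhiSummand_pos`), each at most the
Gaussian majorant `G(N+1+k) ≤ G(N+1) 2^{−k}`, and `Σ_k 2^{−k} = 2`. [folklore] -/
theorem UniversalFactor.stub_phiTailN :
    ∀ (N : ℕ) (u : ℝ), 1 ≤ N → 0 ≤ u →
    0 ≤ deBruijnPhi u - ∑ n ∈ Finset.range N, deBruijnPhiSummand n u ∧
    deBruijnPhi u - ∑ n ∈ Finset.range N, deBruijnPhiSummand n u ≤
      4 * Real.pi ^ 2 * ((N : ℝ) + 1) ^ 4 * Real.exp (9 * u) *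
        Real.exp (-(Real.pi * ((N : ℝ) + 1) ^ 2 * Real.exp (4 * u))) := by
  intro N u _hN hu
  have hs : Summable fun n : ℕ => deBruijnPhiSummand n u := summable_deBruijnPhi_holds u
  have hsN : Summable fun k : ℕ => deBruijnPhiSummand (k + N) u := (summable_nat_add_iff N).2 hs
  have htail : deBruijnPhi u - ∑ n ∈ Finset.range N, deBruijnPhiSummand n u =
      ∑' k : ℕ, deBruijnPhiSummand (k + N) u := by
    rw [deBruijnPhi, ← hs.sum_add_tsum_nat_add N, add_sub_cancel_left]
  rw [htail]
  refine ⟨tsum_nonneg fun k => (deBruijnPhiSummand_pos (k + N) hu).le, ?_⟩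
  -- the Gaussian majorant as a function of the real parameter `m = n + 1`
  set G : ℝ → ℝ := fun m => 2 * Real.pi ^ 2 * m ^ 4 * Real.exp (9 * u) *
      Real.exp (-(Real.pi * m ^ 2 * Real.exp (4 * u))) with hG
  have hN1 : (1 : ℝ) ≤ (N : ℝ) + 1 := by simp
  have hterm : ∀ k : ℕ, deBruijnPhiSummand (k + N) u ≤ G ((N : ℝ) + 1) * (1 / 2) ^ k := by
    intro k
    calc deBruijnPhiSummand (k + N) u ≤ G (((k + N : ℕ) : ℝ) + 1) :=
          UniversalFactor.phiTailN_summand_le (k + N) u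
      _ = G ((N : ℝ) + 1 + k) := by
          congr 1
          push_cast
          ring
      _ ≤ G ((N : ℝ) + 1) * (1 / 2) ^ k :=
          UniversalFactor.phiTailN_geom_of_succ_le
            (fun m hm => UniversalFactor.phiTailN_majorant_succ_le hm hu) hN1 k
  have hgeom : Summable fun k : ℕ => G ((N : ℝ) + 1) * (1 / 2 : ℝ) ^ k :=
    (summable_geometric_of_lt_one (by norm_num) (by norm_num)).mul_left _
  calc ∑' k : ℕ, deBruijnPhiSummand (k + N) u
      ≤ ∑' k : ℕ, G ((N : ℝ) + 1) * (1 / 2 : ℝ) ^ k := hsN.tsum_le_tsum hterm hgeom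
    _ = G ((N : ℝ) + 1) * ∑' k : ℕ, (1 / 2 : ℝ) ^ k := tsum_mul_left
    _ = G ((N : ℝ) + 1) * 2 := by
        rw [tsum_geometric_of_lt_one (by norm_num) (by norm_num)]
        norm_num
    _ = 4 * Real.pi ^ 2 * ((N : ℝ) + 1) ^ 4 * Real.exp (9 * u) *
          Real.exp (-(Real.pi * ((N : ℝ) + 1) ^ 2 * Real.exp (4 * u))) := by
        simp only [hG]
        ring

end Summit.RiemannHypothesis.RiemannHypothesis.Theorems
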